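import Literature.IUT.LogVolume.DegreeVolumeConversion
import Literature.IUT.LogVolume.Theorem110LocalBounds
import HarnessLib

/-!
# Dupuy–Hilado's log-measure `ln ν̄_𝕃` IS [IUTchIV]'s procession-normalized weighted average:
# the assembly of per-summand log-volume bounds into global ones

Two vocabularies for ONE bookkeeping, both already in this directory:

* Dupuy–Hilado, *The statement of Mochizuki's Corollary 3.12*, arXiv:2004.13228, Def. 3.6.1 / 3.6.3
  (typed in `DegreeVolumeConversion.lean` over the interface `PacketModel F`): for a random measurable set
  `B = (B_{v⃗})` of `𝕃`, `ln ν̄_{𝔸^{⊗ j+1}_{V̲,p}}(B) = 𝔼(log μ̄_{v⃗}(B_{v⃗}) : v⃗ ∈ V(F)_p^{j+1})` with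
  `Pr(v) = [F_v:ℚ_p]/[F:ℚ]` (`PacketModel.lnνTensorPower`), `ln ν̄_{𝕃_p}(B) = 𝔼(… | 1 ≤ j ≤ l⋇)`
  (`PacketModel.lnνLp`), `ln ν̄_𝕃(B) = Σ_p ln ν̄_{𝕃_p}(B_p)` (`PacketModel.lnνL`);
* Mochizuki, *Inter-universal Teichmüller theory IV*, RIMS manuscript (Apr. 2020; = PRIMS **57** (2021)),
  proof of Theorem 1.10, Step (iv) (p. 26–27): "we proceed to estimate this log-volume at each `v_ℚ ∈ 𝕍_ℚ`.
  Once one fixes `v_ℚ`, this amounts to estimating the component of this log-volume in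
  “`ℐ^ℚ(^{S±_{j+1}};_{n,∘}𝒟^⊢_{v_ℚ})`” … for each `j ∈ {1, …, l⋇}` … and then computing the average, over
  `j ∈ {1, …, l⋇}`, of these estimates. … for each collection `{v_i}_{i ∈ S±_{j+1}}` of [not necessarily
  distinct!] elements of `𝕍(F_mod)_{v_ℚ}`, we must estimate the component of the log-volume in question
  corresponding to the tensor product of the ℚ-spans of the log-shells associated to this collection … and
  then compute the weighted average [cf. the discussion of Remark 1.7.1], over possible collections
  `{v_i}_{i ∈ S±_{j+1}}`, of these estimates" — typed in `Theorem110LocalBounds.lean` (abc-iut-S3) as the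
  operators `Thm110Local.DstLocal.wavg` (the weights `λ_Πe⃗/Σλ_Πe⃗` of Prop. 1.7 / Rmk. 1.7.1 with
  `λ_v = [(F_mod)_v : ℚ_{v_ℚ}]`) and `Thm110Local.procAvg` (`(1/l⋇)·Σ_{j=1}^{l⋇}`).

WHAT IS PROVED (model-independent: any `PacketModel F`, any region; no side taken on anything):
* `prod_weight_eq_tupleLam_div`, `sum_tupleLam_localDegree` — `Π_k Pr(v_k) = λ_Πe⃗/[F:ℚ]^{j+1}` and
  `Σ_{e⃗} λ_Πe⃗ = [F:ℚ]^{j+1}` (the fundamental identity `Σ_{v|p} n_v = [F:ℚ]`, `sum_localDegree`);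
* `Thm110Local.DstLocal.wavg_eq_sum_mul_weight` — for local data `D` at `v_ℚ = p` whose weights are
  `λ_v = n_v = [F_v:ℚ_p]`, the weighted average `wavg` of Prop. 1.7 of ANY per-collection quantity IS the
  Dupuy–Hilado expectation over `V(F)_p^{j+1}`; hence `PacketModel.lnνTensorPower_eq_wavg`:
  `ln ν̄_{𝔸^{⊗ j+1}_{V̲,p}}(B) = wavg_{e⃗}(log μ̄_{e⃗}(B_{e⃗}))`;
* `PacketModel.lnνLp_eq_procAvg` — `ln ν̄_{𝕃_p}(B) = procAvg_{j}(ln ν̄_{𝔸^{⊗ j+1}}(B))`, and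
  `PacketModel.lnνL_eq_sum_procAvg_wavg` — `ln ν̄_𝕃(B) = Σ_{p ∈ T} procAvg_j wavg_{e⃗} log μ̄_{e⃗}(B_{p,j,e⃗})`;
* THE ASSEMBLY OF BOUNDS. (a) `PacketModel.lnνL_le_add_sum` / `lnνL_le_add_sum_procAvg_wavg`: from
  per-summand bounds `log μ̄(H_{p,j,e⃗}) ≤ log μ̄(R_{p,j,e⃗}) + δ(p,j,e⃗)` (`p ∈ T`, `1 ≤ j ≤ l⋇`) the global
  `ln ν̄_𝕃(H) ≤ ln ν̄_𝕃(R) + Σ_p procAvg_j wavg_{e⃗} δ` — the SHAPE of the L-DH hypothesis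
  `Summit.ABC.IUTFork.DHData.EstimateDH δ` ("[IUTchIV] Thm. 1.10 Steps (iv)–(x) would supply `δ`") with
  `H = hull(U_Θ)`, `R = O_𝕃(−P_Θ)`; (b) `PacketModel.lnνL_eq_sum_dst_add` / `lnνL_le_sum_dst_procAvg_wavg`:
  if the components of `H` off a set `dst ⊆ T` of "distinguished" primes have `log μ̄ ≤ 0` (the shape of
  Step (vi), p. 29: "Such an upper bound “0” is given in the final equality of Proposition 1.4, (iv) …
  The resulting “procession-normalized upper bound” is clearly equal to 0"), then
  `ln ν̄_𝕃(H) = Σ_{p ∈ dst} procAvg_j wavg_{e⃗} log μ̄(H_{p,j,e⃗}) + Z` with `Z ≤ 0` — the SHAPE of the field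
  `negLogTheta_le` (with `vol := ` the components of `hull(U_Θ)` and WITHOUT the archimedean term, which the
  L-DH level does not carry) of `Thm110Numerics.LocalProofData` (`Theorem110Assembly.lean`).
So, once `−|log(Θ)|` is read as `ln ν̄_𝕃(hull(U_Θ))` (c312-3's `DHData.negLogThetaDH`), the REMAINING
inputs of the computable half of [IUTchIII] Cor. 3.12 / [IUTchIV] Thm. 1.10 ("D9′" of the cell's
`plan/LDH-SPEC.md`) are exactly the PER-SUMMAND component bounds of Steps (v) and (vi) at a concrete packet
model — nothing global.

[cite: DupuyHilado2025, Def. 3.6.1, Def. 3.6.3, §3.6] [cite: Mochizuki2012, IUTchIV Thm 1.10 proof Step (iv)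
p.26–27, Step (vi) p.29, Step (viii) p.30] Deliberately NOT here: the per-summand bounds themselves
(Props. 1.4, 1.5, (R4); the (Ind1)(Ind2)(Ind3) containments), archimedean summands, the normalisation
dictionary `−|log(Θ)| ↔ ln ν̄_𝕃`, any judgement on [IUTchIII] Cor. 3.12. Typed ≠ endorsed.
-/

noncomputable section

namespace Literature.IUT.LogVolume

open Finset NumberField IsDedekindDomain
open Literature.Algebra.PolynomialIdentities.WeightedAverage Thm110Local

variable {F : Type*} [Field F] [NumberField F]

/-! ## The places over `p` as the index set "`E = 𝕍(F_mod)_{v_ℚ}`" of Prop. 1.7 -/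

/-- For a prime `p`, `V(F)_p ≠ ∅` as a type (Prop. 1.7's "`E` a nonempty finite set" at `E = 𝕍(F_mod)_{v_ℚ}`;
use with `haveI` — stated as a theorem, not an instance). [cite: DupuyHilado2025, §3.6] -/
theorem nonempty_placesOver (p : ℕ) [Fact p.Prime] : Nonempty (placesOver F p) :=
  let ⟨v, hv⟩ := placesOver_nonempty F p
  ⟨⟨v, hv⟩⟩

/-- `Π_k Pr(v_k) = λ_Πe⃗ / [F:ℚ]^{j+1}` for a tuple `e⃗ = (v_0,…,v_j)`, where `Pr(v) = n_v/[F:ℚ]` (DH §3.6) and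
`λ_Πe⃗ = Π_k n_{v_k}` (the weight "`λ_Πe⃗`" of [IUTchIV] Prop. 1.7 with `λ_v = [F_v:ℚ_p]`).
[cite: DupuyHilado2025, §3.6] -/
theorem prod_weight_eq_tupleLam_div {p n : ℕ} (e : Fin n → placesOver F p) :
    ∏ k, weight F (e k).1 =
      tupleLam (fun v : placesOver F p => (localDegree F v.1 : ℝ)) e / (Module.finrank ℚ F : ℝ) ^ n := by
  unfold weight tupleLam
  rw [Finset.prod_div_distrib, Finset.prod_const, Finset.card_univ, Fintype.card_fin]

/-- `Σ_{e⃗ ∈ V(F)_p^{n}} λ_Πe⃗ = [F:ℚ]^{n}` — the first display of the proof of Prop. 1.7 (`λ_E^n = Σ λ_Πe⃗`)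
together with the fundamental identity `λ_E = Σ_{v|p} n_v = [F:ℚ]`.
[cite: Mochizuki2012, IUTchIV Prop 1.7 proof p.17] -/
theorem sum_tupleLam_localDegree (p : ℕ) [Fact p.Prime] (n : ℕ) :
    ∑ e : Fin n → placesOver F p, tupleLam (fun v : placesOver F p => (localDegree F v.1 : ℝ)) e =
      (Module.finrank ℚ F : ℝ) ^ n := by
  rw [← lamTotal_pow]
  congr 1
  unfold lamTotal
  rw [Finset.sum_coe_sort (placesOver F p) (fun v => (localDegree F v : ℝ))]
  exact_mod_cast sum_localDegree F p

namespace Thm110Local.DstLocal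

/-- **The weighted average of Prop. 1.7 / Rmk. 1.7.1 IS the Dupuy–Hilado expectation over tuples.** For local
data `D` at `v_ℚ = p` with the weights `λ_v = n_v = [F_v:ℚ_p]` and ANY per-collection quantity `g`:
`wavg_{e⃗ ∈ E^{n}}(g) = (Σ_{e⃗} g(e⃗)·λ_Πe⃗)/(Σ_{e⃗} λ_Πe⃗) = Σ_{e⃗} g(e⃗)·Π_k Pr(v_k) = 𝔼(g(v⃗) : v⃗ ∈ V(F)_p^{n})`.
[cite: Mochizuki2012, IUTchIV Rmk 1.7.1 p.17] -/
theorem wavg_eq_sum_mul_weight {p : ℕ} [Fact p.Prime] (D : DstLocal (placesOver F p))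
    (hlam : ∀ v, D.lam v = localDegree F v.1) (n : ℕ) (g : (Fin n → placesOver F p) → ℝ) :
    D.wavg n g = ∑ e : Fin n → placesOver F p, g e * ∏ k, weight F (e k).1 := by
  have hl : D.lam = fun v : placesOver F p => (localDegree F v.1 : ℝ) := funext hlam
  unfold DstLocal.wavg
  rw [hl, sum_tupleLam_localDegree, Finset.sum_div]
  refine Finset.sum_congr rfl fun e _ => ?_
  rw [prod_weight_eq_tupleLam_div, mul_div_assoc]

/-- The weighted average of Rmk. 1.7.1 (weights `λ_v = n_v`) is monotone in the averaged per-collection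
quantity (the weights `Π_k Pr(v_k)` are nonnegative). [cite: Mochizuki2012, IUTchIV Rmk 1.7.1 p.17] -/
theorem wavg_mono_of_lam {p : ℕ} [Fact p.Prime] (D : DstLocal (placesOver F p))
    (hlam : ∀ v, D.lam v = localDegree F v.1) (n : ℕ) {g₁ g₂ : (Fin n → placesOver F p) → ℝ}
    (h : ∀ e, g₁ e ≤ g₂ e) : D.wavg n g₁ ≤ D.wavg n g₂ := by
  rw [D.wavg_eq_sum_mul_weight hlam, D.wavg_eq_sum_mul_weight hlam]
  exact Finset.sum_le_sum fun e _ =>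
    mul_le_mul_of_nonneg_right (h e) (Finset.prod_nonneg fun k _ => weight_nonneg F (e k).1)

end Thm110Local.DstLocal

/-! ## `Σ_{i : Fin l⋇} f(i+1) = Σ_{j ∈ {1,…,l⋇}} f(j)` -/

/-- Re-indexing the procession: `Σ_{i=0}^{l⋇−1} f(i+1) = Σ_{j=1}^{l⋇} f(j)`. [folklore] -/
private theorem sum_fin_succ_eq_sum_Icc (n : ℕ) (f : ℕ → ℝ) :
    ∑ i : Fin n, f ((i : ℕ) + 1) = ∑ j ∈ Icc 1 n, f j := by
  induction n with
  | zero => simp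
  | succ k ih =>
    rw [Fin.sum_univ_castSucc, Finset.sum_Icc_succ_top (by omega), ← ih]
    simp

namespace PacketModel

variable (M : PacketModel F)

/-! ## `ln ν̄` in the vocabulary of [IUTchIV] Step (iv) -/

/-- **`ln ν̄_{𝔸^{⊗ j+1}_{V̲,p}}(B)` is the weighted average of Prop. 1.7 / Rmk. 1.7.1** of the components
`log μ̄_{v⃗}(B_{v⃗})` over the collections `v⃗ ∈ 𝕍(F)_p^{j+1}`, for any local data `D` at `p` with the weights
`λ_v = [F_v:ℚ_p]`. [cite: DupuyHilado2025, §3.6] -/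
theorem lnνTensorPower_eq_wavg {p : ℕ} [Fact p.Prime] (D : DstLocal (placesOver F p))
    (hlam : ∀ v, D.lam v = localDegree F v.1) (j : ℕ) (B : M.Region) :
    M.lnνTensorPower p j B = D.wavg (j + 1) (fun e => M.logμ (B p j e)) := by
  rw [D.wavg_eq_sum_mul_weight hlam]
  rfl

/-- **`ln ν̄_{𝕃_p}(B)` is the procession average** `(1/l⋇)·Σ_{j=1}^{l⋇} ln ν̄_{𝔸^{⊗ j+1}_{V̲,p}}(B)` ("computing the
average, over `j ∈ {1, …, l⋇}`, of these estimates", Step (iv)). [cite: DupuyHilado2025, Def. 3.6.3] -/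
theorem lnνLp_eq_procAvg (lstar p : ℕ) (B : M.Region) :
    M.lnνLp lstar p B = procAvg lstar (fun j => M.lnνTensorPower p j B) := by
  unfold lnνLp procAvg
  rw [sum_fin_succ_eq_sum_Icc lstar (fun j => M.lnνTensorPower p j B)]

/-- **`ln ν̄_𝕃(B)` in the vocabulary of Step (iv)**: over a finite set `T` of primes,
`ln ν̄_𝕃(B) = Σ_{p ∈ T} procAvg_{j} wavg_{e⃗} log μ̄_{e⃗}(B_{p,j,e⃗})`, for any family of local data `D_p` with the
weights `λ_v = [F_v:ℚ_p]`. [cite: DupuyHilado2025, Def. 3.6.3] -/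
theorem lnνL_eq_sum_procAvg_wavg (lstar : ℕ) (T : Finset ℕ) (hT : ∀ p ∈ T, p.Prime)
    (D : (p : ℕ) → DstLocal (placesOver F p)) (hlam : ∀ p ∈ T, ∀ v, (D p).lam v = localDegree F v.1)
    (B : M.Region) :
    M.lnνL lstar T B =
      ∑ p ∈ T, procAvg lstar (fun j =>
        @DstLocal.wavg _ _ (D p) (j + 1) (fun e => M.logμ (B p j e))) := by
  unfold lnνL
  refine Finset.sum_congr rfl fun p hp => ?_
  haveI : Fact p.Prime := ⟨hT p hp⟩
  rw [M.lnνLp_eq_procAvg]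
  unfold procAvg
  congr 1
  refine Finset.sum_congr rfl fun j _ => ?_
  exact M.lnνTensorPower_eq_wavg (D p) (hlam p hp) j B

/-! ## Sign of the averages from the sign of the components -/

/-- If every component of `B` in tensor degree `j` over `p` has `log μ̄ ≤ 0`, then `ln ν̄_{𝔸^{⊗ j+1}_{V̲,p}}(B) ≤ 0`
(the weights are nonnegative). [cite: DupuyHilado2025, §3.6] -/
theorem lnνTensorPower_nonpos {p j : ℕ} {B : M.Region} (h : ∀ e, M.logμ (B p j e) ≤ 0) :
    M.lnνTensorPower p j B ≤ 0 :=
  Finset.sum_nonpos fun e _ =>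
    mul_nonpos_of_nonpos_of_nonneg (h e) (Finset.prod_nonneg fun k _ => weight_nonneg F (e k).1)

/-- If every component of `B` over `p` in the tensor degrees `1 ≤ j ≤ l⋇` has `log μ̄ ≤ 0`, then
`ln ν̄_{𝕃_p}(B) ≤ 0` — the shape of Step (vi) (p. 29): per-collection bound "`0`" ⇒ "the resulting
“procession-normalized upper bound” is clearly equal to `0`". [cite: Mochizuki2012, IUTchIV Thm 1.10 proof Step (vi) p.29] -/
theorem lnνLp_nonpos {lstar p : ℕ} {B : M.Region}
    (h : ∀ j, 1 ≤ j → j ≤ lstar → ∀ e, M.logμ (B p j e) ≤ 0) : M.lnνLp lstar p B ≤ 0 := by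
  unfold lnνLp
  refine mul_nonpos_of_nonneg_of_nonpos (by positivity) (Finset.sum_nonpos fun i _ => ?_)
  exact M.lnνTensorPower_nonpos fun e => h _ (by omega) (by omega) e

/-! ## (b) Splitting off the distinguished primes: the shape of `LocalProofData.negLogTheta_le` -/

/-- `ln ν̄_𝕃(B) = Σ_{p} ln ν̄_{𝕃_p}(B_p)` over `T` splits as the part over `dst ⊆ T` plus the part over `T ∖ dst`
(Step (viii): "sum over `v_ℚ ∈ 𝕍_ℚ` the various local “procession-normalized upper bounds” obtained in Steps
(v), (vi), (vii)"). [cite: DupuyHilado2025, Def. 3.6.3] -/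
theorem lnνL_eq_sum_dst_add (lstar : ℕ) {T dst : Finset ℕ} (hdst : dst ⊆ T) (B : M.Region) :
    M.lnνL lstar T B = (∑ p ∈ dst, M.lnνLp lstar p B) + ∑ p ∈ T \ dst, M.lnνLp lstar p B := by
  unfold lnνL
  rw [← Finset.sum_sdiff hdst, add_comm]

/-- **Step (vi) assembled**: if off the distinguished primes every relevant component of `H` has `log μ̄ ≤ 0`,
the non-distinguished contribution `Z := Σ_{p ∈ T∖dst} ln ν̄_{𝕃_p}(H)` is `≤ 0`.
[cite: Mochizuki2012, IUTchIV Thm 1.10 proof Step (vi) p.29] -/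
theorem sum_sdiff_lnνLp_nonpos (lstar : ℕ) {T dst : Finset ℕ} {H : M.Region}
    (hoff : ∀ p ∈ T, p ∉ dst → ∀ j, 1 ≤ j → j ≤ lstar → ∀ e, M.logμ (H p j e) ≤ 0) :
    ∑ p ∈ T \ dst, M.lnνLp lstar p H ≤ 0 :=
  Finset.sum_nonpos fun p hp => by
    rw [Finset.mem_sdiff] at hp
    exact M.lnνLp_nonpos (hoff p hp.1 hp.2)

/-- Hence `ln ν̄_𝕃(H) ≤ Σ_{p ∈ dst} ln ν̄_{𝕃_p}(H)` under the Step (vi)-shaped vanishing off `dst`.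
[cite: Mochizuki2012, IUTchIV Thm 1.10 proof Steps (vi), (viii) pp.29–30] -/
theorem lnνL_le_sum_dst (lstar : ℕ) {T dst : Finset ℕ} (hdst : dst ⊆ T) {H : M.Region}
    (hoff : ∀ p ∈ T, p ∉ dst → ∀ j, 1 ≤ j → j ≤ lstar → ∀ e, M.logμ (H p j e) ≤ 0) :
    M.lnνL lstar T H ≤ ∑ p ∈ dst, M.lnνLp lstar p H := by
  rw [M.lnνL_eq_sum_dst_add lstar hdst]
  have := M.sum_sdiff_lnνLp_nonpos lstar hoff
  linarith

/-- **The shape of `Thm110Numerics.LocalProofData.negLogTheta_le` at the L-DH level.** Let `T` be primes,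
`dst ⊆ T` the distinguished ones, `D_p` local data with `λ_v = [F_v:ℚ_p]`, and suppose the components of
`H` off `dst` (degrees `1 ≤ j ≤ l⋇`) have `log μ̄ ≤ 0` (Step (vi)). Then, with `vol(p, j, e⃗) := log μ̄(H_{p,j,e⃗})`
and `Z := Σ_{p ∈ T∖dst} ln ν̄_{𝕃_p}(H) ≤ 0`:
`ln ν̄_𝕃(H) = Σ_{p ∈ dst} procAvg_j wavg_{e⃗} vol + Z` ("it suffices to sum over `v_ℚ ∈ 𝕍_ℚ` the various
local “procession-normalized upper bounds”", Step (viii), p. 30).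
[cite: Mochizuki2012, IUTchIV Thm 1.10 proof Steps (iv), (vi), (viii) pp.26–30] -/
theorem lnνL_eq_sum_dst_procAvg_wavg_add (lstar : ℕ) {T dst : Finset ℕ} (hdst : dst ⊆ T)
    (hT : ∀ p ∈ T, p.Prime) (D : (p : ℕ) → DstLocal (placesOver F p))
    (hlam : ∀ p ∈ dst, ∀ v, (D p).lam v = localDegree F v.1) {H : M.Region}
    (hoff : ∀ p ∈ T, p ∉ dst → ∀ j, 1 ≤ j → j ≤ lstar → ∀ e, M.logμ (H p j e) ≤ 0) :
    ∃ Z : ℝ, Z ≤ 0 ∧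
      M.lnνL lstar T H =
        (∑ p ∈ dst, procAvg lstar (fun j =>
          @DstLocal.wavg _ _ (D p) (j + 1) (fun e => M.logμ (H p j e)))) + Z := by
  refine ⟨∑ p ∈ T \ dst, M.lnνLp lstar p H, M.sum_sdiff_lnνLp_nonpos lstar hoff, ?_⟩
  rw [M.lnνL_eq_sum_dst_add lstar hdst]
  congr 1
  have hdstT : ∀ p ∈ dst, p.Prime := fun p hp => hT p (hdst hp)
  rw [← M.lnνL_eq_sum_procAvg_wavg lstar dst hdstT D hlam H]
  rfl

/-- The same as an inequality: `ln ν̄_𝕃(H) ≤ Σ_{p ∈ dst} procAvg_j wavg_{e⃗} log μ̄(H_{p,j,e⃗})`.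
[cite: Mochizuki2012, IUTchIV Thm 1.10 proof Steps (iv), (vi), (viii) pp.26–30] -/
theorem lnνL_le_sum_dst_procAvg_wavg (lstar : ℕ) {T dst : Finset ℕ} (hdst : dst ⊆ T)
    (hT : ∀ p ∈ T, p.Prime) (D : (p : ℕ) → DstLocal (placesOver F p))
    (hlam : ∀ p ∈ dst, ∀ v, (D p).lam v = localDegree F v.1) {H : M.Region}
    (hoff : ∀ p ∈ T, p ∉ dst → ∀ j, 1 ≤ j → j ≤ lstar → ∀ e, M.logμ (H p j e) ≤ 0) :
    M.lnνL lstar T H ≤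
      ∑ p ∈ dst, procAvg lstar (fun j =>
        @DstLocal.wavg _ _ (D p) (j + 1) (fun e => M.logμ (H p j e))) := by
  obtain ⟨Z, hZ, hEq⟩ := M.lnνL_eq_sum_dst_procAvg_wavg_add lstar hdst hT D hlam hoff
  linarith

/-! ## (a) Componentwise bounds with discrepancies: the shape of `DHData.EstimateDH` -/

/-- Per-summand bounds `log μ̄(H_{v⃗}) ≤ log μ̄(R_{v⃗}) + δ(v⃗)` in tensor degree `j` over `p` give
`ln ν̄_{𝔸^{⊗ j+1}}(H) ≤ ln ν̄_{𝔸^{⊗ j+1}}(R) + Σ_{v⃗} δ(v⃗)·Π_k Pr(v_k)`. [cite: DupuyHilado2025, §3.6] -/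
theorem lnνTensorPower_le_add_sum {p j : ℕ} {H R : M.Region}
    (δ : (Fin (j + 1) → placesOver F p) → ℝ) (h : ∀ e, M.logμ (H p j e) ≤ M.logμ (R p j e) + δ e) :
    M.lnνTensorPower p j H ≤ M.lnνTensorPower p j R + ∑ e, δ e * ∏ k, weight F (e k).1 := by
  unfold lnνTensorPower
  rw [← Finset.sum_add_distrib]
  refine Finset.sum_le_sum fun e _ => ?_
  rw [← add_mul]
  exact mul_le_mul_of_nonneg_right (h e) (Finset.prod_nonneg fun k _ => weight_nonneg F (e k).1)

/-- … and over `𝕃_p`: `ln ν̄_{𝕃_p}(H) ≤ ln ν̄_{𝕃_p}(R) + (1/l⋇)·Σ_{j} Σ_{v⃗} δ(p,j,v⃗)·Π_k Pr(v_k)`.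
[cite: DupuyHilado2025, Def. 3.6.3] -/
theorem lnνLp_le_add_sum {lstar p : ℕ} {H R : M.Region}
    (δ : (j : ℕ) → (Fin (j + 1) → placesOver F p) → ℝ)
    (h : ∀ j, 1 ≤ j → j ≤ lstar → ∀ e, M.logμ (H p j e) ≤ M.logμ (R p j e) + δ j e) :
    M.lnνLp lstar p H ≤ M.lnνLp lstar p R +
      (1 / (lstar : ℝ)) * ∑ i : Fin lstar, ∑ e, δ ((i : ℕ) + 1) e * ∏ k, weight F (e k).1 := by
  unfold lnνLp
  rw [← mul_add, ← Finset.sum_add_distrib]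
  refine mul_le_mul_of_nonneg_left (Finset.sum_le_sum fun i _ => ?_) (by positivity)
  exact M.lnνTensorPower_le_add_sum (δ ((i : ℕ) + 1)) fun e => h _ (by omega) (by omega) e

/-- **Assembly of componentwise bounds with discrepancies** (the shape of `DHData.EstimateDH`): per-summand
bounds `log μ̄(H_{p,j,v⃗}) ≤ log μ̄(R_{p,j,v⃗}) + δ(p,j,v⃗)` for `p ∈ T`, `1 ≤ j ≤ l⋇` give
`ln ν̄_𝕃(H) ≤ ln ν̄_𝕃(R) + Σ_{p ∈ T} (1/l⋇)·Σ_{j=1}^{l⋇} Σ_{v⃗} δ(p,j,v⃗)·Π_k Pr(v_k)`. With `H = hull(U_Θ)`,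
`R = O_𝕃(−P_Θ)` and `δ` the per-collection discrepancies of [IUTchIV] Thm. 1.10 Steps (v)–(vi), the
right-hand constant is the `δ` that "Steps (iv)–(x) would supply". [cite: DupuyHilado2025, Def. 3.6.3] -/
theorem lnνL_le_add_sum (lstar : ℕ) (T : Finset ℕ) {H R : M.Region}
    (δ : (p j : ℕ) → (Fin (j + 1) → placesOver F p) → ℝ)
    (h : ∀ p ∈ T, ∀ j, 1 ≤ j → j ≤ lstar → ∀ e, M.logμ (H p j e) ≤ M.logμ (R p j e) + δ p j e) :
    M.lnνL lstar T H ≤ M.lnνL lstar T R +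
      ∑ p ∈ T, (1 / (lstar : ℝ)) * ∑ i : Fin lstar, ∑ e, δ p ((i : ℕ) + 1) e * ∏ k, weight F (e k).1 := by
  unfold lnνL
  rw [← Finset.sum_add_distrib]
  exact Finset.sum_le_sum fun p hp => M.lnνLp_le_add_sum (δ p) (h p hp)

/-- The same with the discrepancy written in the vocabulary of Step (iv): for `T` primes and local data
`D_p` with `λ_v = [F_v:ℚ_p]`,
`ln ν̄_𝕃(H) ≤ ln ν̄_𝕃(R) + Σ_{p ∈ T} procAvg_j wavg_{e⃗} δ(p,j,e⃗)`.
[cite: Mochizuki2012, IUTchIV Thm 1.10 proof Steps (iv), (viii) pp.26–30] -/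
theorem lnνL_le_add_sum_procAvg_wavg (lstar : ℕ) (T : Finset ℕ) (hT : ∀ p ∈ T, p.Prime)
    (D : (p : ℕ) → DstLocal (placesOver F p)) (hlam : ∀ p ∈ T, ∀ v, (D p).lam v = localDegree F v.1)
    {H R : M.Region} (δ : (p j : ℕ) → (Fin (j + 1) → placesOver F p) → ℝ)
    (h : ∀ p ∈ T, ∀ j, 1 ≤ j → j ≤ lstar → ∀ e, M.logμ (H p j e) ≤ M.logμ (R p j e) + δ p j e) :
    M.lnνL lstar T H ≤ M.lnνL lstar T R +
      ∑ p ∈ T, procAvg lstar (fun j => @DstLocal.wavg _ _ (D p) (j + 1) (δ p j)) := by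
  refine (M.lnνL_le_add_sum lstar T δ h).trans (le_of_eq ?_)
  congr 1
  refine Finset.sum_congr rfl fun p hp => ?_
  haveI : Fact p.Prime := ⟨hT p hp⟩
  unfold procAvg
  rw [← sum_fin_succ_eq_sum_Icc lstar (fun j => @DstLocal.wavg _ _ (D p) (j + 1) (δ p j))]
  congr 1
  refine Finset.sum_congr rfl fun i _ => ?_
  rw [(D p).wavg_eq_sum_mul_weight (hlam p hp)]

/-- **Direct componentwise bounds**: `log μ̄(H_{p,j,v⃗}) ≤ b(p,j,v⃗)` for `p ∈ T` (primes), `1 ≤ j ≤ l⋇` give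
`ln ν̄_𝕃(H) ≤ Σ_{p ∈ T} procAvg_j wavg_{e⃗} b(p,j,e⃗)` — the form in which Step (v)'s per-collection bounds
(`Thm110Local.DstLocal.collBound`) are consumed by `Thm110Local.hull_bound_of_local_bounds`.
[cite: Mochizuki2012, IUTchIV Thm 1.10 proof Steps (iv)–(v), (viii) pp.26–30] -/
theorem lnνL_le_sum_procAvg_wavg_of_le (lstar : ℕ) (T : Finset ℕ) (hT : ∀ p ∈ T, p.Prime)
    (D : (p : ℕ) → DstLocal (placesOver F p)) (hlam : ∀ p ∈ T, ∀ v, (D p).lam v = localDegree F v.1)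
    {H : M.Region} (b : (p j : ℕ) → (Fin (j + 1) → placesOver F p) → ℝ)
    (h : ∀ p ∈ T, ∀ j, 1 ≤ j → j ≤ lstar → ∀ e, M.logμ (H p j e) ≤ b p j e) :
    M.lnνL lstar T H ≤ ∑ p ∈ T, procAvg lstar (fun j => @DstLocal.wavg _ _ (D p) (j + 1) (b p j)) := by
  rw [M.lnνL_eq_sum_procAvg_wavg lstar T hT D hlam H]
  refine Finset.sum_le_sum fun p hp => ?_
  haveI : Fact p.Prime := ⟨hT p hp⟩
  unfold procAvg
  refine mul_le_mul_of_nonneg_left (Finset.sum_le_sum fun j hj => ?_) (by positivity)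
  rw [Finset.mem_Icc] at hj
  exact (D p).wavg_mono_of_lam (hlam p hp) (j + 1) (fun e => h p hp j hj.1 hj.2 e)

end PacketModel

end Literature.IUT.LogVolume

end
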